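/- Free-seat work of EXTRA WIDTH SEAT `ym-line-cbag-p1-w5` (prover-ym-line-cbag-p1-w5-g2-0), route `EguchiKawaiDirectionLadder`
(ideator ym-idea-2, LINE 8), crux `TripleSmallBallMargin` (stmt-QuantumFields-27724), LEAD g24's v7 architecture, STUB S6 (GrNet):
PART 1 (grid): operator-norm bookkeeping for the conjugation orbit of the base projection `P₀ = headProj r s`, its stabiliser
`blockDiag₂ (U(r) × U(s))`, and the Haar measure of the translated grid of balls around a separated family in the stabiliser —
the packing input of the `N`-UNIFORM GRASSMANNIAN NET (`EguchiKawaiDirectionLadderGrassmannianNet.lean`, `#𝒩 ≤ 33^{N²} ρ^{−2rs}`), itself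
the entropy input of the rank-robust rigidity primitives (S7/S8) where the margin `e > 3/4` of the crux lives.  Built from the tree's two-sided
Haar small-ball bounds for `U(n)` alone.  Route-independent.  Nothing here bears on the Yang–Mills mass gap
(barrier-ledger line onto `EguchiKawaiBreakdown`). -/
import Literature.Barriers.QuantumFields.UnitaryHaarSmallBallUpper
import Literature.Computability.QuantumComplexity.PlaceGateNorm
import Summits.QuantumFields.YangMills.Theorems.EguchiKawaiDirectionLadderGrassmannianNetDefs

/-!
# Route `EguchiKawaiDirectionLadder`, stub S6 (Grassmannian net), part 1: the grid in the stabiliser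

* operator-norm bookkeeping: `‖U‖ ≤ 1`, `‖V X‖ = ‖X‖`, `‖V X V⋆‖ ≤ ‖X‖`, and the Lipschitz bound `‖U P U⋆ − W P W⋆‖ ≤ 2‖U − W‖`;
* `headProj r s` is a `0/1` diagonal (`‖P₀‖ ≤ 1`) fixed by `blockDiag₂ A B` under conjugation;
* the block-diagonal grid is separated: `‖blockDiag₂ A B − blockDiag₂ A' B'‖ ≥ ‖A − A'‖, ‖B − B'‖`;
* `exists_separated_card_ge`: a `2δ`-separated family in `U(n)` with `#P · (3δ)^{n²} ≥ 1` (tree: `exists_separated_net` +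
  `one_le_card_net_mul_pow`);
* `measure_grid_ge`: the `δ`-balls around `V · blockDiag₂(P_r × P_s)` are disjoint with total Haar measure
  `≥ #P_r #P_s (δ/(2π+δ))^{N²}` (`haar_unitaryOpBall_ge`); `grid_subset_conjBall`: that union lies in `{U : ‖UP₀U⋆ − VP₀V⋆‖ ≤ 2δ}`.
-/

set_option autoImplicit false

noncomputable section

open MeasureTheory
open scoped Matrix Matrix.Norms.L2Operator ENNReal Real
open Literature.Barriers.QuantumFields

namespace Summit.QuantumFields.YangMills.Theorems.EguchiKawaiDirectionLadder

namespace GrNet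

/-! ### Operator-norm bookkeeping -/

/-- `‖1‖ ≤ 1` for the ℓ²-operator norm on square complex matrices (`= 1` unless the index type is empty). -/
theorem norm_one_le_one (n : ℕ) : ‖(1 : Matrix (Fin n) (Fin n) ℂ)‖ ≤ 1 := by
  rw [← Matrix.diagonal_one, Matrix.l2_opNorm_diagonal]
  refine (pi_norm_le_iff_of_nonneg zero_le_one).2 fun i => ?_
  simp

/-- A unitary matrix has operator norm `≤ 1`. -/
theorem norm_coe_unitary_le_one {n : ℕ} (U : Matrix.unitaryGroup (Fin n) ℂ) :
    ‖(U : Matrix (Fin n) (Fin n) ℂ)‖ ≤ 1 := by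
  have h : ‖(U : Matrix (Fin n) (Fin n) ℂ)‖ * ‖(U : Matrix (Fin n) (Fin n) ℂ)‖ ≤ 1 := by
    rw [← Matrix.l2_opNorm_conjTranspose_mul_self, ← Matrix.star_eq_conjTranspose,
      Matrix.UnitaryGroup.star_mul_self]
    exact norm_one_le_one n
  nlinarith [norm_nonneg (U : Matrix (Fin n) (Fin n) ℂ)]

/-- Left multiplication by a unitary is an isometry of the operator norm. -/
theorem norm_unitary_mul {n : ℕ} (V : Matrix.unitaryGroup (Fin n) ℂ) (X : Matrix (Fin n) (Fin n) ℂ) :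
    ‖(V : Matrix (Fin n) (Fin n) ℂ) * X‖ = ‖X‖ := by
  refine le_antisymm ?_ ?_
  · calc ‖(V : Matrix (Fin n) (Fin n) ℂ) * X‖ ≤ ‖(V : Matrix (Fin n) (Fin n) ℂ)‖ * ‖X‖ := Matrix.l2_opNorm_mul _ _
      _ ≤ 1 * ‖X‖ := mul_le_mul_of_nonneg_right (norm_coe_unitary_le_one V) (norm_nonneg _)
      _ = ‖X‖ := one_mul _
  · have hX : X = star (V : Matrix (Fin n) (Fin n) ℂ) * ((V : Matrix (Fin n) (Fin n) ℂ) * X) := by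
      rw [← Matrix.mul_assoc, Matrix.UnitaryGroup.star_mul_self, Matrix.one_mul]
    calc ‖X‖ = ‖star (V : Matrix (Fin n) (Fin n) ℂ) * ((V : Matrix (Fin n) (Fin n) ℂ) * X)‖ := by rw [← hX]
      _ ≤ ‖star (V : Matrix (Fin n) (Fin n) ℂ)‖ * ‖(V : Matrix (Fin n) (Fin n) ℂ) * X‖ := Matrix.l2_opNorm_mul _ _
      _ ≤ 1 * ‖(V : Matrix (Fin n) (Fin n) ℂ) * X‖ := by
          refine mul_le_mul_of_nonneg_right ?_ (norm_nonneg _)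
          rw [Matrix.star_eq_conjTranspose, Matrix.l2_opNorm_conjTranspose]
          exact norm_coe_unitary_le_one V
      _ = _ := one_mul _

/-- Conjugation by a unitary does not increase the operator norm. -/
theorem norm_unitary_conj_le {n : ℕ} (V : Matrix.unitaryGroup (Fin n) ℂ) (X : Matrix (Fin n) (Fin n) ℂ) :
    ‖(V : Matrix (Fin n) (Fin n) ℂ) * X * (V : Matrix (Fin n) (Fin n) ℂ)ᴴ‖ ≤ ‖X‖ := by
  calc ‖(V : Matrix (Fin n) (Fin n) ℂ) * X * (V : Matrix (Fin n) (Fin n) ℂ)ᴴ‖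
      ≤ ‖(V : Matrix (Fin n) (Fin n) ℂ) * X‖ * ‖(V : Matrix (Fin n) (Fin n) ℂ)ᴴ‖ := Matrix.l2_opNorm_mul _ _
    _ ≤ ‖(V : Matrix (Fin n) (Fin n) ℂ) * X‖ * 1 := by
        refine mul_le_mul_of_nonneg_left ?_ (norm_nonneg _)
        rw [Matrix.l2_opNorm_conjTranspose]; exact norm_coe_unitary_le_one V
    _ = ‖X‖ := by rw [mul_one, norm_unitary_mul]

/-- **Lipschitz bound for the conjugation orbit map**: `‖U P U⋆ − W P W⋆‖ ≤ 2 ‖U − W‖` for unitaries `U, W` and `‖P‖ ≤ 1`. -/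
theorem norm_conj_sub_conj_le {n : ℕ} (U W : Matrix.unitaryGroup (Fin n) ℂ) {P : Matrix (Fin n) (Fin n) ℂ}
    (hP : ‖P‖ ≤ 1) :
    ‖(U : Matrix (Fin n) (Fin n) ℂ) * P * (U : Matrix (Fin n) (Fin n) ℂ)ᴴ -
        (W : Matrix (Fin n) (Fin n) ℂ) * P * (W : Matrix (Fin n) (Fin n) ℂ)ᴴ‖ ≤
      2 * ‖(U : Matrix (Fin n) (Fin n) ℂ) - (W : Matrix (Fin n) (Fin n) ℂ)‖ := by
  set u : Matrix (Fin n) (Fin n) ℂ := (U : Matrix (Fin n) (Fin n) ℂ)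
  set w : Matrix (Fin n) (Fin n) ℂ := (W : Matrix (Fin n) (Fin n) ℂ)
  have hsplit : u * P * uᴴ - w * P * wᴴ = (u - w) * P * uᴴ + w * P * (uᴴ - wᴴ) := by
    simp only [sub_mul, mul_sub, Matrix.mul_assoc]; abel
  have hu : ‖u‖ ≤ 1 := norm_coe_unitary_le_one U
  have hw : ‖w‖ ≤ 1 := norm_coe_unitary_le_one W
  have huH : ‖uᴴ‖ ≤ 1 := by rw [Matrix.l2_opNorm_conjTranspose]; exact hu
  have h1 : ‖(u - w) * P * uᴴ‖ ≤ ‖u - w‖ := by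
    calc ‖(u - w) * P * uᴴ‖ ≤ ‖(u - w) * P‖ * ‖uᴴ‖ := Matrix.l2_opNorm_mul _ _
      _ ≤ (‖u - w‖ * ‖P‖) * ‖uᴴ‖ := mul_le_mul_of_nonneg_right (Matrix.l2_opNorm_mul _ _) (norm_nonneg _)
      _ ≤ (‖u - w‖ * 1) * 1 := by gcongr
      _ = ‖u - w‖ := by ring
  have h2 : ‖w * P * (uᴴ - wᴴ)‖ ≤ ‖u - w‖ := by
    have hH : ‖uᴴ - wᴴ‖ = ‖u - w‖ := by
      rw [← Matrix.conjTranspose_sub, Matrix.l2_opNorm_conjTranspose]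
    calc ‖w * P * (uᴴ - wᴴ)‖ ≤ ‖w * P‖ * ‖uᴴ - wᴴ‖ := Matrix.l2_opNorm_mul _ _
      _ ≤ (‖w‖ * ‖P‖) * ‖uᴴ - wᴴ‖ := mul_le_mul_of_nonneg_right (Matrix.l2_opNorm_mul _ _) (norm_nonneg _)
      _ ≤ (1 * 1) * ‖uᴴ - wᴴ‖ := by gcongr
      _ = ‖u - w‖ := by rw [one_mul, one_mul, hH]
  calc ‖u * P * uᴴ - w * P * wᴴ‖ = ‖(u - w) * P * uᴴ + w * P * (uᴴ - wᴴ)‖ := by rw [hsplit]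
    _ ≤ ‖(u - w) * P * uᴴ‖ + ‖w * P * (uᴴ - wᴴ)‖ := norm_add_le _ _
    _ ≤ ‖u - w‖ + ‖u - w‖ := add_le_add h1 h2
    _ = 2 * ‖u - w‖ := by ring

/-! ### The base projection and its stabiliser -/

/-- `headProj r s` is the `0/1` diagonal matrix of the first `r` coordinates. -/
theorem headProj_eq_diagonal (r s : ℕ) :
    headProj r s = Matrix.diagonal (fun i : Fin (r + s) =>
      Sum.elim (fun _ : Fin r => (1 : ℂ)) (fun _ : Fin s => (0 : ℂ)) (finSumFinEquiv.symm i)) := by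
  unfold headProj
  rw [← Matrix.diagonal_one, ← Matrix.diagonal_zero, Matrix.fromBlocks_diagonal, Matrix.reindex_apply,
    Matrix.submatrix_diagonal_equiv]
  rfl

/-- `‖headProj r s‖ ≤ 1`. -/
theorem norm_headProj_le_one (r s : ℕ) : ‖headProj r s‖ ≤ 1 := by
  rw [headProj_eq_diagonal, Matrix.l2_opNorm_diagonal]
  refine (pi_norm_le_iff_of_nonneg zero_le_one).2 fun i => ?_
  rcases finSumFinEquiv.symm i with a | b <;> simp

/-- **The block-diagonal unitaries stabilise the base projection**: `(blockDiag₂ A B) P₀ (blockDiag₂ A B)⋆ = P₀`. -/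
theorem blockDiag₂_conj_headProj {r s : ℕ} (A : Matrix.unitaryGroup (Fin r) ℂ) (B : Matrix.unitaryGroup (Fin s) ℂ) :
    ((blockDiag₂ A B : Matrix.unitaryGroup (Fin (r + s)) ℂ) : Matrix (Fin (r + s)) (Fin (r + s)) ℂ) * headProj r s *
        ((blockDiag₂ A B : Matrix.unitaryGroup (Fin (r + s)) ℂ) : Matrix (Fin (r + s)) (Fin (r + s)) ℂ)ᴴ =
      headProj r s := by
  have hA : (A : Matrix (Fin r) (Fin r) ℂ) * (A : Matrix (Fin r) (Fin r) ℂ)ᴴ = 1 := by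
    have := Matrix.mem_unitaryGroup_iff.mp A.2
    rwa [Matrix.star_eq_conjTranspose] at this
  rw [coe_blockDiag₂]
  unfold headProj
  rw [Matrix.reindex_apply, Matrix.reindex_apply, Matrix.conjTranspose_submatrix, Matrix.submatrix_mul_equiv,
    Matrix.submatrix_mul_equiv, Matrix.fromBlocks_conjTranspose, Matrix.fromBlocks_multiply, Matrix.fromBlocks_multiply]
  congr 1
  simp [hA]

/-- **The grid is separated**: `‖A − A'‖ ≤ ‖blockDiag₂ A B − blockDiag₂ A' B'‖` (first block). -/
theorem norm_sub_le_norm_blockDiag₂_sub_left {r s : ℕ} (A A' : Matrix.unitaryGroup (Fin r) ℂ)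
    (B B' : Matrix.unitaryGroup (Fin s) ℂ) :
    ‖(A : Matrix (Fin r) (Fin r) ℂ) - (A' : Matrix (Fin r) (Fin r) ℂ)‖ ≤
      ‖((blockDiag₂ A B : Matrix.unitaryGroup (Fin (r + s)) ℂ) : Matrix (Fin (r + s)) (Fin (r + s)) ℂ) -
        ((blockDiag₂ A' B' : Matrix.unitaryGroup (Fin (r + s)) ℂ) : Matrix (Fin (r + s)) (Fin (r + s)) ℂ)‖ := by
  set X : Matrix (Fin r) (Fin r) ℂ := (A : Matrix (Fin r) (Fin r) ℂ) - (A' : Matrix (Fin r) (Fin r) ℂ) with hX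
  set Y : Matrix (Fin s) (Fin s) ℂ := (B : Matrix (Fin s) (Fin s) ℂ) - (B' : Matrix (Fin s) (Fin s) ℂ) with hY
  have hdiff : ((blockDiag₂ A B : Matrix.unitaryGroup (Fin (r + s)) ℂ) : Matrix (Fin (r + s)) (Fin (r + s)) ℂ) -
      ((blockDiag₂ A' B' : Matrix.unitaryGroup (Fin (r + s)) ℂ) : Matrix (Fin (r + s)) (Fin (r + s)) ℂ) =
      Matrix.reindex finSumFinEquiv finSumFinEquiv (Matrix.fromBlocks X 0 0 Y) := by
    rw [coe_blockDiag₂, coe_blockDiag₂, Matrix.reindex_apply, Matrix.reindex_apply, Matrix.reindex_apply]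
    ext i j
    simp only [Matrix.sub_apply, Matrix.submatrix_apply]
    generalize finSumFinEquiv.symm i = a
    generalize finSumFinEquiv.symm j = b
    rcases a with a | a <;> rcases b with b | b <;> simp [Matrix.fromBlocks, hX, hY]
  rw [hdiff, Literature.Computability.QuantumComplexity.l2_opNorm_reindex]
  -- ‖X‖ ≤ ‖fromBlocks X 0 0 Y‖: test on vectors supported in the first summand
  set M : Matrix (Fin r ⊕ Fin s) (Fin r ⊕ Fin s) ℂ := Matrix.fromBlocks X 0 0 Y with hM
  rw [← Matrix.l2_opNorm_toEuclideanCLM]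
  refine ContinuousLinearMap.opNorm_le_bound _ (norm_nonneg _) fun x => ?_
  -- the padded vector
  set v : EuclideanSpace ℂ (Fin r ⊕ Fin s) := WithLp.toLp 2 (Sum.elim (WithLp.ofLp x) 0) with hv
  have hvnorm : ‖v‖ = ‖x‖ := by
    rw [EuclideanSpace.norm_eq, EuclideanSpace.norm_eq]
    congr 1
    rw [Fintype.sum_sum_type]
    simp [hv]
  have hMv : ‖WithLp.toLp 2 (M.mulVec (WithLp.ofLp v)) - (0 : EuclideanSpace ℂ (Fin r ⊕ Fin s))‖ ≤ ‖M‖ * ‖v‖ := by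
    rw [sub_zero]
    exact Matrix.l2_opNorm_mulVec M v
  have hMv' : WithLp.toLp 2 (M.mulVec (WithLp.ofLp v)) =
      (WithLp.toLp 2 (Sum.elim (X.mulVec (WithLp.ofLp x)) 0) : EuclideanSpace ℂ (Fin r ⊕ Fin s)) := by
    rw [hM, hv]
    simp [Matrix.fromBlocks_mulVec]
  have hnorm2 : ‖(WithLp.toLp 2 (Sum.elim (X.mulVec (WithLp.ofLp x)) 0) : EuclideanSpace ℂ (Fin r ⊕ Fin s))‖ =
      ‖Matrix.toEuclideanCLM (n := Fin r) (𝕜 := ℂ) X x‖ := by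
    rw [EuclideanSpace.norm_eq, EuclideanSpace.norm_eq]
    congr 1
    rw [Fintype.sum_sum_type]
    simp [Matrix.ofLp_toEuclideanCLM]
  calc ‖Matrix.toEuclideanCLM (n := Fin r) (𝕜 := ℂ) X x‖
      = ‖WithLp.toLp 2 (M.mulVec (WithLp.ofLp v)) - (0 : EuclideanSpace ℂ (Fin r ⊕ Fin s))‖ := by
        rw [sub_zero, hMv', hnorm2]
    _ ≤ ‖M‖ * ‖v‖ := hMv
    _ = ‖M‖ * ‖x‖ := by rw [hvnorm]

/-- **The grid is separated**: `‖B − B'‖ ≤ ‖blockDiag₂ A B − blockDiag₂ A' B'‖` (second block). -/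
theorem norm_sub_le_norm_blockDiag₂_sub_right {r s : ℕ} (A A' : Matrix.unitaryGroup (Fin r) ℂ)
    (B B' : Matrix.unitaryGroup (Fin s) ℂ) :
    ‖(B : Matrix (Fin s) (Fin s) ℂ) - (B' : Matrix (Fin s) (Fin s) ℂ)‖ ≤
      ‖((blockDiag₂ A B : Matrix.unitaryGroup (Fin (r + s)) ℂ) : Matrix (Fin (r + s)) (Fin (r + s)) ℂ) -
        ((blockDiag₂ A' B' : Matrix.unitaryGroup (Fin (r + s)) ℂ) : Matrix (Fin (r + s)) (Fin (r + s)) ℂ)‖ := by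
  set X : Matrix (Fin r) (Fin r) ℂ := (A : Matrix (Fin r) (Fin r) ℂ) - (A' : Matrix (Fin r) (Fin r) ℂ) with hX
  set Y : Matrix (Fin s) (Fin s) ℂ := (B : Matrix (Fin s) (Fin s) ℂ) - (B' : Matrix (Fin s) (Fin s) ℂ) with hY
  have hdiff : ((blockDiag₂ A B : Matrix.unitaryGroup (Fin (r + s)) ℂ) : Matrix (Fin (r + s)) (Fin (r + s)) ℂ) -
      ((blockDiag₂ A' B' : Matrix.unitaryGroup (Fin (r + s)) ℂ) : Matrix (Fin (r + s)) (Fin (r + s)) ℂ) =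
      Matrix.reindex finSumFinEquiv finSumFinEquiv (Matrix.fromBlocks X 0 0 Y) := by
    rw [coe_blockDiag₂, coe_blockDiag₂, Matrix.reindex_apply, Matrix.reindex_apply, Matrix.reindex_apply]
    ext i j
    simp only [Matrix.sub_apply, Matrix.submatrix_apply]
    generalize finSumFinEquiv.symm i = a
    generalize finSumFinEquiv.symm j = b
    rcases a with a | a <;> rcases b with b | b <;> simp [Matrix.fromBlocks, hX, hY]
  rw [hdiff, Literature.Computability.QuantumComplexity.l2_opNorm_reindex]
  set M : Matrix (Fin r ⊕ Fin s) (Fin r ⊕ Fin s) ℂ := Matrix.fromBlocks X 0 0 Y with hM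
  rw [← Matrix.l2_opNorm_toEuclideanCLM]
  refine ContinuousLinearMap.opNorm_le_bound _ (norm_nonneg _) fun x => ?_
  set v : EuclideanSpace ℂ (Fin r ⊕ Fin s) := WithLp.toLp 2 (Sum.elim 0 (WithLp.ofLp x)) with hv
  have hvnorm : ‖v‖ = ‖x‖ := by
    rw [EuclideanSpace.norm_eq, EuclideanSpace.norm_eq]
    congr 1
    rw [Fintype.sum_sum_type]
    simp [hv]
  have hMv : ‖WithLp.toLp 2 (M.mulVec (WithLp.ofLp v)) - (0 : EuclideanSpace ℂ (Fin r ⊕ Fin s))‖ ≤ ‖M‖ * ‖v‖ := by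
    rw [sub_zero]
    exact Matrix.l2_opNorm_mulVec M v
  have hMv' : WithLp.toLp 2 (M.mulVec (WithLp.ofLp v)) =
      (WithLp.toLp 2 (Sum.elim 0 (Y.mulVec (WithLp.ofLp x))) : EuclideanSpace ℂ (Fin r ⊕ Fin s)) := by
    rw [hM, hv]
    simp [Matrix.fromBlocks_mulVec]
  have hnorm2 : ‖(WithLp.toLp 2 (Sum.elim 0 (Y.mulVec (WithLp.ofLp x))) : EuclideanSpace ℂ (Fin r ⊕ Fin s))‖ =
      ‖Matrix.toEuclideanCLM (n := Fin s) (𝕜 := ℂ) Y x‖ := by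
    rw [EuclideanSpace.norm_eq, EuclideanSpace.norm_eq]
    congr 1
    rw [Fintype.sum_sum_type]
    simp [Matrix.ofLp_toEuclideanCLM]
  calc ‖Matrix.toEuclideanCLM (n := Fin s) (𝕜 := ℂ) Y x‖
      = ‖WithLp.toLp 2 (M.mulVec (WithLp.ofLp v)) - (0 : EuclideanSpace ℂ (Fin r ⊕ Fin s))‖ := by
        rw [sub_zero, hMv', hnorm2]
    _ ≤ ‖M‖ * ‖v‖ := hMv
    _ = ‖M‖ * ‖x‖ := by rw [hvnorm]

/-! ### Separated families in `U(n)` with many points (tree: packing/covering) -/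

/-- A `2ρ`-separated family in `U(n)` with at least `(3ρ)^{−n²}` points (a maximal separated family is a `2ρ`-net, and nets are
large: `one_le_card_net_mul_pow`). -/
theorem exists_separated_card_ge (n : ℕ) {ρ : ℝ} (hρ : 0 < ρ) :
    ∃ P : Finset (Matrix.unitaryGroup (Fin n) ℂ),
      (∀ g ∈ P, ∀ g' ∈ P, g ≠ g' →
        2 * ρ < ‖(g : Matrix (Fin n) (Fin n) ℂ) - (g' : Matrix (Fin n) (Fin n) ℂ)‖) ∧
      (1 : ℝ) ≤ P.card * (3 * ρ) ^ (n * n) := by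
  obtain ⟨P, hsep, hnet⟩ := exists_separated_net (N := n) hρ
  exact ⟨P, hsep, one_le_card_net_mul_pow P hρ hnet⟩

/-! ### The translated grid of balls around the stabiliser -/

section Grid

variable {r s : ℕ}

/-- The Haar probability measure of `U(r+s)` is left invariant (instance plumbing, as in `UnitaryHaarSmallBallUpper`). -/
theorem isMulLeftInvariant_haar (n : ℕ) :
    (Literature.MathematicalPhysics.QuantumFieldTheory.haarProbability (Matrix.unitaryGroup (Fin n) ℂ)).IsMulLeftInvariant := by
  dsimp [Literature.MathematicalPhysics.QuantumFieldTheory.haarProbability]; infer_instance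

/-- Centres of the grid are `2δ`-separated: for `(A,B) ≠ (A',B')` from `2δ`-separated families,
`2δ < ‖V·blockDiag₂ A B − V·blockDiag₂ A' B'‖`. -/
theorem grid_centres_separated (V : Matrix.unitaryGroup (Fin (r + s)) ℂ) {δ : ℝ}
    {Pr : Finset (Matrix.unitaryGroup (Fin r) ℂ)} {Ps : Finset (Matrix.unitaryGroup (Fin s) ℂ)}
    (hPr : ∀ g ∈ Pr, ∀ g' ∈ Pr, g ≠ g' → 2 * δ < ‖(g : Matrix (Fin r) (Fin r) ℂ) - (g' : Matrix (Fin r) (Fin r) ℂ)‖)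
    (hPs : ∀ g ∈ Ps, ∀ g' ∈ Ps, g ≠ g' → 2 * δ < ‖(g : Matrix (Fin s) (Fin s) ℂ) - (g' : Matrix (Fin s) (Fin s) ℂ)‖)
    {p q : Matrix.unitaryGroup (Fin r) ℂ × Matrix.unitaryGroup (Fin s) ℂ} (hp : p ∈ Pr ×ˢ Ps) (hq : q ∈ Pr ×ˢ Ps)
    (hpq : p ≠ q) :
    2 * δ < ‖((V * blockDiag₂ p.1 p.2 : Matrix.unitaryGroup (Fin (r + s)) ℂ) : Matrix (Fin (r + s)) (Fin (r + s)) ℂ) -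
      ((V * blockDiag₂ q.1 q.2 : Matrix.unitaryGroup (Fin (r + s)) ℂ) : Matrix (Fin (r + s)) (Fin (r + s)) ℂ)‖ := by
  rw [Finset.mem_product] at hp hq
  have hfac : ((V * blockDiag₂ p.1 p.2 : Matrix.unitaryGroup (Fin (r + s)) ℂ) : Matrix (Fin (r + s)) (Fin (r + s)) ℂ) -
      ((V * blockDiag₂ q.1 q.2 : Matrix.unitaryGroup (Fin (r + s)) ℂ) : Matrix (Fin (r + s)) (Fin (r + s)) ℂ) =
      (V : Matrix (Fin (r + s)) (Fin (r + s)) ℂ) *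
        (((blockDiag₂ p.1 p.2 : Matrix.unitaryGroup (Fin (r + s)) ℂ) : Matrix (Fin (r + s)) (Fin (r + s)) ℂ) -
          ((blockDiag₂ q.1 q.2 : Matrix.unitaryGroup (Fin (r + s)) ℂ) : Matrix (Fin (r + s)) (Fin (r + s)) ℂ)) := by
    rw [Matrix.mul_sub]; rfl
  rw [hfac, norm_unitary_mul]
  by_cases h1 : p.1 = q.1
  · have h2 : p.2 ≠ q.2 := fun h2 => hpq (Prod.ext h1 h2)
    exact (hPs p.2 hp.2 q.2 hq.2 h2).trans_le (norm_sub_le_norm_blockDiag₂_sub_right _ _ _ _)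
  · exact (hPr p.1 hp.1 q.1 hq.1 h1).trans_le (norm_sub_le_norm_blockDiag₂_sub_left _ _ _ _)

/-- **Measure of the translated grid of `δ`-balls**: disjoint by separation, each of Haar measure `≥ (δ/(2π+δ))^{N²}`, so
`μ(⋃ balls) ≥ #P_r · #P_s · (δ/(2π+δ))^{N²}`. -/
theorem measure_grid_ge (V : Matrix.unitaryGroup (Fin (r + s)) ℂ) {δ : ℝ} (hδ : 0 < δ)
    {Pr : Finset (Matrix.unitaryGroup (Fin r) ℂ)} {Ps : Finset (Matrix.unitaryGroup (Fin s) ℂ)}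
    (hPr : ∀ g ∈ Pr, ∀ g' ∈ Pr, g ≠ g' → 2 * δ < ‖(g : Matrix (Fin r) (Fin r) ℂ) - (g' : Matrix (Fin r) (Fin r) ℂ)‖)
    (hPs : ∀ g ∈ Ps, ∀ g' ∈ Ps, g ≠ g' → 2 * δ < ‖(g : Matrix (Fin s) (Fin s) ℂ) - (g' : Matrix (Fin s) (Fin s) ℂ)‖) :
    (Pr.card : ℝ≥0∞) * Ps.card * ENNReal.ofReal ((δ / (2 * π + δ)) ^ ((r + s) * (r + s))) ≤
      Literature.MathematicalPhysics.QuantumFieldTheory.haarProbability (Matrix.unitaryGroup (Fin (r + s)) ℂ)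
        (⋃ p ∈ Pr ×ˢ Ps, (fun W => (V * blockDiag₂ p.1 p.2)⁻¹ * W) ⁻¹' unitaryOpBall (r + s) δ) := by
  haveI := isMulLeftInvariant_haar (r + s)
  set μ := Literature.MathematicalPhysics.QuantumFieldTheory.haarProbability (Matrix.unitaryGroup (Fin (r + s)) ℂ) with hμ
  set Bl : Matrix.unitaryGroup (Fin r) ℂ × Matrix.unitaryGroup (Fin s) ℂ → Set (Matrix.unitaryGroup (Fin (r + s)) ℂ) :=
    fun p => (fun W => (V * blockDiag₂ p.1 p.2)⁻¹ * W) ⁻¹' unitaryOpBall (r + s) δ with hBl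
  have hmeas : ∀ p, MeasurableSet (Bl p) := fun p =>
    (measurableSet_unitaryOpBall δ).preimage (measurable_const_mul _)
  have hdisj : ((Pr ×ˢ Ps : Finset _) : Set (Matrix.unitaryGroup (Fin r) ℂ × Matrix.unitaryGroup (Fin s) ℂ)).PairwiseDisjoint Bl := by
    intro p hp q hq hpq
    rw [Function.onFun, Set.disjoint_left]
    intro W hWp hWq
    rw [hBl, mem_preimage_unitaryOpBall_iff] at hWp hWq
    have hsep := grid_centres_separated V hPr hPs hp hq hpq
    have : ‖((V * blockDiag₂ p.1 p.2 : Matrix.unitaryGroup (Fin (r + s)) ℂ) : Matrix (Fin (r + s)) (Fin (r + s)) ℂ) -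
        ((V * blockDiag₂ q.1 q.2 : Matrix.unitaryGroup (Fin (r + s)) ℂ) : Matrix (Fin (r + s)) (Fin (r + s)) ℂ)‖ ≤ 2 * δ := by
      calc _ = ‖(((V * blockDiag₂ p.1 p.2 : Matrix.unitaryGroup (Fin (r + s)) ℂ) : Matrix (Fin (r + s)) (Fin (r + s)) ℂ) - W) +
            ((W : Matrix (Fin (r + s)) (Fin (r + s)) ℂ) - (V * blockDiag₂ q.1 q.2 : Matrix.unitaryGroup (Fin (r + s)) ℂ))‖ := by
              rw [sub_add_sub_cancel]
        _ ≤ δ + δ := (norm_add_le _ _).trans (add_le_add (by rw [norm_sub_rev]; exact hWp) hWq)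
        _ = 2 * δ := by ring
    linarith
  have hball : ENNReal.ofReal ((δ / (2 * π + δ)) ^ ((r + s) * (r + s))) ≤ μ (unitaryOpBall (r + s) δ) :=
    haar_unitaryOpBall_ge μ hδ
  calc (Pr.card : ℝ≥0∞) * Ps.card * ENNReal.ofReal ((δ / (2 * π + δ)) ^ ((r + s) * (r + s)))
      ≤ (Pr.card : ℝ≥0∞) * Ps.card * μ (unitaryOpBall (r + s) δ) := mul_le_mul' le_rfl hball
    _ = ∑ p ∈ Pr ×ˢ Ps, μ (Bl p) := by
        have hBp : ∀ p, μ (Bl p) = μ (unitaryOpBall (r + s) δ) := fun p => by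
          rw [hBl]; exact measure_preimage_mul μ _ _
        rw [Finset.sum_congr rfl (fun p _ => hBp p), Finset.sum_const, Finset.card_product, nsmul_eq_mul,
          Nat.cast_mul, mul_assoc]
    _ = μ (⋃ p ∈ Pr ×ˢ Ps, Bl p) := (measure_biUnion_finset hdisj (fun p _ => hmeas p)).symm

/-- **The grid sits inside a `2δ`-ball of the Grassmannian pseudo-metric**: a unitary within `δ` of `V·blockDiag₂ A B` has
its conjugate of `P₀` within `2δ` of `V P₀ V⋆` (the block-diagonal factor fixes `P₀`). -/
theorem grid_subset_conjBall (V : Matrix.unitaryGroup (Fin (r + s)) ℂ) (δ : ℝ)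
    (Pr : Finset (Matrix.unitaryGroup (Fin r) ℂ)) (Ps : Finset (Matrix.unitaryGroup (Fin s) ℂ)) :
    (⋃ p ∈ Pr ×ˢ Ps, (fun W => (V * blockDiag₂ p.1 p.2)⁻¹ * W) ⁻¹' unitaryOpBall (r + s) δ) ⊆
      {U : Matrix.unitaryGroup (Fin (r + s)) ℂ |
        ‖(U : Matrix (Fin (r + s)) (Fin (r + s)) ℂ) * headProj r s * (U : Matrix (Fin (r + s)) (Fin (r + s)) ℂ)ᴴ -
          (V : Matrix (Fin (r + s)) (Fin (r + s)) ℂ) * headProj r s * (V : Matrix (Fin (r + s)) (Fin (r + s)) ℂ)ᴴ‖ ≤ 2 * δ} := by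
  intro U hU
  obtain ⟨p, -, hUp⟩ := Set.mem_iUnion₂.1 hU
  rw [mem_preimage_unitaryOpBall_iff] at hUp
  have hconj := norm_conj_sub_conj_le U (V * blockDiag₂ p.1 p.2) (norm_headProj_le_one r s)
  have hfix : ((V * blockDiag₂ p.1 p.2 : Matrix.unitaryGroup (Fin (r + s)) ℂ) : Matrix (Fin (r + s)) (Fin (r + s)) ℂ) *
        headProj r s * ((V * blockDiag₂ p.1 p.2 : Matrix.unitaryGroup (Fin (r + s)) ℂ) : Matrix (Fin (r + s)) (Fin (r + s)) ℂ)ᴴ =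
      (V : Matrix (Fin (r + s)) (Fin (r + s)) ℂ) * headProj r s * (V : Matrix (Fin (r + s)) (Fin (r + s)) ℂ)ᴴ := by
    have hcoe : ((V * blockDiag₂ p.1 p.2 : Matrix.unitaryGroup (Fin (r + s)) ℂ) : Matrix (Fin (r + s)) (Fin (r + s)) ℂ) =
        (V : Matrix (Fin (r + s)) (Fin (r + s)) ℂ) *
          ((blockDiag₂ p.1 p.2 : Matrix.unitaryGroup (Fin (r + s)) ℂ) : Matrix (Fin (r + s)) (Fin (r + s)) ℂ) := rfl
    rw [hcoe, Matrix.conjTranspose_mul]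
    have h := blockDiag₂_conj_headProj p.1 p.2
    calc (V : Matrix (Fin (r + s)) (Fin (r + s)) ℂ) *
          ((blockDiag₂ p.1 p.2 : Matrix.unitaryGroup (Fin (r + s)) ℂ) : Matrix (Fin (r + s)) (Fin (r + s)) ℂ) * headProj r s *
          ((((blockDiag₂ p.1 p.2 : Matrix.unitaryGroup (Fin (r + s)) ℂ) : Matrix (Fin (r + s)) (Fin (r + s)) ℂ))ᴴ *
            (V : Matrix (Fin (r + s)) (Fin (r + s)) ℂ)ᴴ)
        = (V : Matrix (Fin (r + s)) (Fin (r + s)) ℂ) *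
            ((((blockDiag₂ p.1 p.2 : Matrix.unitaryGroup (Fin (r + s)) ℂ) : Matrix (Fin (r + s)) (Fin (r + s)) ℂ)) * headProj r s *
              (((blockDiag₂ p.1 p.2 : Matrix.unitaryGroup (Fin (r + s)) ℂ) : Matrix (Fin (r + s)) (Fin (r + s)) ℂ))ᴴ) *
            (V : Matrix (Fin (r + s)) (Fin (r + s)) ℂ)ᴴ := by
          simp only [Matrix.mul_assoc]
      _ = _ := by rw [h]
  rw [hfix] at hconj
  exact hconj.trans (by linarith)

end Grid


end GrNet

end Summit.QuantumFields.YangMills.Theorems.EguchiKawaiDirectionLadder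

end
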